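import Summits.ValiantsHypothesis.ValiantsHypothesis.Theorems.LacunarySymmetroidMatrixDescartesCensusDoorA34OpenFailure

/-!
# `MatrixDescartes` census — DOOR A at `(3,4)`: the door is decided by pencils with LINEARLY INDEPENDENT letters

HONEST FRAMING.  Object-search cell `pub-symmetroid`, door-A seat `val-sym-door-p3` (g23); a STRUCTURE row `--supports` the route
item `Theses.LacunarySymmetroid.DoorA34` (stmt-ValiantsHypothesis-19980, `DoorA34 = PosRootLawAt 3 4 18`), which is OPEN and asserted
nowhere in this file.  The cell's charts of a `(3,4)` pencil (hollow corner `…HollowCornerChart`, node forms, the classes R4 / R2 / R0)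
presuppose four linearly independent letters; the degenerate nets (letter span of dimension `≤ 3`) are bounded only in part
(`…CensusDoorA34RankTwoNet`: span `≤ 2` ⇒ `≤ 9`; `…CensusDoorA34ReducibleCone`: reducible cones ⇒ `≤ 12`; irreducible cones open).
This file shows that for the DOOR ITSELF the degenerate nets are immaterial:

* **`doorA34_iff_linearIndependent`** — `DoorA34` holds iff every real SYMMETRIC `3 × 3` four-letter pencil whose letters are LINEARLY
  INDEPENDENT (in the space of `3 × 3` matrices) has at most `18` distinct positive det-roots, on every support.

Proof: a failure of the door is an open condition in the letters (`Census.exists_open_failure_of_not_doorA34`, door-p3 g9: `19` sign-change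
brackets persist); inside the open ball of failing letter quadruples there is a symmetric quadruple with independent letters — perturb
along the elementary symmetric matrices `E₀₀, E₁₁, E₂₂, E₀₁+E₁₀` by an `η` that is not a root of the quartic `det(C₀ + η·1)` (`C₀` = the
`4 × 4` matrix of the four diagonal/`(0,1)` coordinates of the letters), such `η` existing in every interval.  The converse direction is
the definition.  Nothing here bounds `ζ_sym(3,4)`; `DoorA34` and `MatrixDescartes` (stmt-ValiantsHypothesis-18050) stay OPEN; nothing bears
on `VP ≠ VNP`.  [folklore] Continuity + Gershgorin (`det_ne_zero_of_sum_row_lt_diag`) + finiteness of polynomial roots.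
-/

-- `Summit.ValiantsHypothesis.ValiantsHypothesis.…` repeats a component by the D-0017 layout
-- (single-conjunct summit), which the `dupNamespace` linter flags; the name is mandated.
set_option linter.dupNamespace false

namespace Summit.ValiantsHypothesis.ValiantsHypothesis.Theorems.LacunarySymmetroidMatrixDescartes.Census

open Polynomial Finset
open scoped BigOperators Polynomial Matrix
open Summit.ValiantsHypothesis.ValiantsHypothesis.Theorems.MatrixDescartes.Negative (PosRootLawAt)

namespace IndependentLetters

/-- For a real square matrix `C₀`, some `η` in any interval `(0, ε)` makes `C₀ + η·1` non-singular: `η ↦ det(C₀ + η·1)` is a non-zero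
polynomial (non-zero at a diagonally dominant shift, by Gershgorin), so it has finitely many roots. [folklore] -/
theorem exists_shift_det_ne_zero {n : ℕ} (C₀ : Matrix (Fin n) (Fin n) ℝ) {ε : ℝ} (hε : 0 < ε) :
    ∃ η : ℝ, 0 < η ∧ η < ε ∧ (C₀ + η • (1 : Matrix (Fin n) (Fin n) ℝ)).det ≠ 0 := by
  classical
  -- the polynomial `p(η) = det(C₀ + η·1)`
  set p : ℝ[X] := (C₀.map C + (X : ℝ[X]) • (1 : Matrix (Fin n) (Fin n) ℝ[X])).det with hp
  have hpeval : ∀ η : ℝ, p.eval η = (C₀ + η • (1 : Matrix (Fin n) (Fin n) ℝ)).det := by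
    intro η
    have h := RingHom.map_det (Polynomial.evalRingHom η) (C₀.map C + (X : ℝ[X]) • (1 : Matrix (Fin n) (Fin n) ℝ[X]))
    rw [Polynomial.coe_evalRingHom] at h
    rw [hp, h]
    congr 1
    ext i j
    rw [RingHom.mapMatrix_apply, Matrix.map_apply, Matrix.add_apply, Matrix.add_apply, Matrix.smul_apply, Matrix.map_apply,
      Matrix.smul_apply, Polynomial.coe_evalRingHom, eval_add, eval_C, smul_eq_mul, smul_eq_mul, eval_mul, eval_X]
    by_cases hij : i = j
    · subst hij; simp
    · simp [Matrix.one_apply_ne hij]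
  -- a diagonally dominant shift
  set η₀ : ℝ := 1 + ∑ i, ∑ j, |C₀ i j| with hη₀
  have hS0 : 0 ≤ ∑ i, ∑ j, |C₀ i j| := Finset.sum_nonneg fun i _ => Finset.sum_nonneg fun j _ => abs_nonneg _
  have hdom : (C₀ + η₀ • (1 : Matrix (Fin n) (Fin n) ℝ)).det ≠ 0 := by
    apply det_ne_zero_of_sum_row_lt_diag
    intro k
    have hrow : ∑ j ∈ Finset.univ.erase k, ‖(C₀ + η₀ • (1 : Matrix (Fin n) (Fin n) ℝ)) k j‖ = ∑ j ∈ Finset.univ.erase k, |C₀ k j| := by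
      refine Finset.sum_congr rfl fun j hj => ?_
      have hjk : j ≠ k := Finset.ne_of_mem_erase hj
      rw [Real.norm_eq_abs, Matrix.add_apply, Matrix.smul_apply, Matrix.one_apply_ne (Ne.symm hjk), smul_zero, add_zero]
    have hdiag : ‖(C₀ + η₀ • (1 : Matrix (Fin n) (Fin n) ℝ)) k k‖ = |C₀ k k + η₀| := by
      rw [Real.norm_eq_abs, Matrix.add_apply, Matrix.smul_apply, Matrix.one_apply_eq, smul_eq_mul, mul_one]
    rw [hrow, hdiag]
    have h1 : ∑ j ∈ Finset.univ.erase k, |C₀ k j| + |C₀ k k| = ∑ j, |C₀ k j| :=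
      Finset.sum_erase_add _ _ (Finset.mem_univ k)
    have h2 : ∑ j, |C₀ k j| ≤ ∑ i, ∑ j, |C₀ i j| :=
      Finset.single_le_sum (f := fun i => ∑ j, |C₀ i j|) (fun i _ => Finset.sum_nonneg fun j _ => abs_nonneg _)
        (Finset.mem_univ k)
    have h3 : C₀ k k + η₀ ≤ |C₀ k k + η₀| := le_abs_self _
    have h4 : -|C₀ k k| ≤ C₀ k k := neg_abs_le _
    linarith
  have hp0 : p ≠ 0 := by
    intro h0
    apply hdom
    rw [← hpeval, h0, eval_zero]
  -- avoid the finitely many roots inside `(0, ε)`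
  obtain ⟨η, hηI, hηR⟩ := (Set.Ioo_infinite hε).exists_notMem_finset p.roots.toFinset
  refine ⟨η, hηI.1, hηI.2, ?_⟩
  rw [← hpeval]
  intro h
  exact hηR (Multiset.mem_toFinset.mpr ((Polynomial.mem_roots hp0).mpr h))

/-- **`DoorA34` IS DECIDED BY INDEPENDENT LETTERS.**  `DoorA34` (every real symmetric `3 × 3` four-letter lacunary pencil has `≤ 18`
distinct positive det-roots, every support) holds iff the same holds for the pencils whose four letters are linearly independent
matrices. [folklore] -/
theorem doorA34_iff_linearIndependent :
    DoorA34 ↔ ∀ (d : Fin 4 → ℕ) (S : Fin 4 → Matrix (Fin 3) (Fin 3) ℝ), (∀ l, (S l).IsSymm) → LinearIndependent ℝ S →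
      (((∑ l, (X : ℝ[X]) ^ d l • (S l).map C).det).roots.toFinset.filter (fun t => 0 < t)).card ≤ 18 := by
  classical
  constructor
  · intro h d S hS _
    exact h d S hS
  · intro h
    by_contra hdoor
    obtain ⟨d, E₀, hE₀, ε, hε, hall⟩ := exists_open_failure_of_not_doorA34 hdoor
    -- the perturbation frame: elementary symmetric matrices at the coordinates (0,0), (1,1), (2,2), (0,1)
    set F : Fin 4 → Fin 3 → Fin 3 → ℝ :=
      ![![![1, 0, 0], ![0, 0, 0], ![0, 0, 0]], ![![0, 0, 0], ![0, 1, 0], ![0, 0, 0]],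
        ![![0, 0, 0], ![0, 0, 0], ![0, 0, 1]], ![![0, 1, 0], ![1, 0, 0], ![0, 0, 0]]] with hF
    set κ : Fin 4 → Fin 3 × Fin 3 := ![(0, 0), (1, 1), (2, 2), (0, 1)] with hκ
    have hFκ : ∀ m l : Fin 4, F l (κ m).1 (κ m).2 = if m = l then 1 else 0 := by
      intro m l
      fin_cases m <;> fin_cases l <;> simp [hF, hκ]
    have hFsymm : ∀ l i j, F l i j = F l j i := by
      intro l i j
      fin_cases l <;> fin_cases i <;> fin_cases j <;> simp [hF]
    have hFle : ∀ l i j, |F l i j| ≤ 1 := by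
      intro l i j
      fin_cases l <;> fin_cases i <;> fin_cases j <;> simp [hF]
    -- the coordinate matrix of the letters and a good shift
    set C₀ : Matrix (Fin 4) (Fin 4) ℝ := fun m l => E₀ l (κ m).1 (κ m).2 with hC₀
    obtain ⟨η, hη0, hηε, hdet⟩ := exists_shift_det_ne_zero C₀ hε
    -- the perturbed letters
    set E : Fin 4 → Fin 3 → Fin 3 → ℝ := fun l i j => E₀ l i j + η * F l i j with hE
    set S : Fin 4 → Matrix (Fin 3) (Fin 3) ℝ := fun l => Matrix.of (E l) with hSdef
    have hSsymm : ∀ l, (S l).IsSymm := by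
      intro l
      have h0 := hE₀ l
      unfold Matrix.IsSymm at h0 ⊢
      ext i j
      have h0ij := congrFun (congrFun h0 i) j
      simp only [Matrix.transpose_apply, Matrix.of_apply] at h0ij
      simp only [hSdef, Matrix.transpose_apply, Matrix.of_apply, hE]
      rw [h0ij, hFsymm l j i]
    have hclose : ∀ l i j, |E l i j - E₀ l i j| < ε := by
      intro l i j
      simp only [hE, add_sub_cancel_left, abs_mul, abs_of_pos hη0]
      calc η * |F l i j| ≤ η * 1 := mul_le_mul_of_nonneg_left (hFle l i j) hη0.le
        _ < ε := by rw [mul_one]; exact hηε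
    have h19 := hall E hclose
    -- independence of the perturbed letters
    have hcoord : ∀ m l : Fin 4, S l (κ m).1 (κ m).2 = (C₀ + η • (1 : Matrix (Fin 4) (Fin 4) ℝ)) m l := by
      intro m l
      simp only [hSdef, Matrix.of_apply, hE, hC₀, Matrix.add_apply, Matrix.smul_apply, hFκ m l, Matrix.one_apply,
        smul_eq_mul]
    have hLI : LinearIndependent ℝ S := by
      rw [Fintype.linearIndependent_iff]
      intro g hg l
      have hvec : (C₀ + η • (1 : Matrix (Fin 4) (Fin 4) ℝ)) *ᵥ g = 0 := by
        ext m
        rw [Matrix.mulVec, dotProduct, Pi.zero_apply]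
        have h1 := congrFun (congrFun hg (κ m).1) (κ m).2
        rw [Matrix.sum_apply, Matrix.zero_apply] at h1
        simp only [Matrix.smul_apply, smul_eq_mul] at h1
        rw [← h1]
        exact Finset.sum_congr rfl fun l' _ => by rw [← hcoord m l', mul_comm]
      have := Matrix.eq_zero_of_mulVec_eq_zero hdet hvec
      exact congrFun this l
    have h18 := h d S hSsymm hLI
    have hSE : (∑ l, (X : ℝ[X]) ^ d l • (S l).map C) = ∑ l, (X : ℝ[X]) ^ d l • (Matrix.of (E l)).map C :=
      Finset.sum_congr rfl fun l _ => by rw [hSdef]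
    rw [hSE] at h18
    omega

end IndependentLetters

end Summit.ValiantsHypothesis.ValiantsHypothesis.Theorems.LacunarySymmetroidMatrixDescartes.Census
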